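import Summits.BirchSwinnertonDyer.BirchSwinnertonDyer.Theorems.ClassRecordThreeEulerHalvesAtThreeCartanTorusCubeCutFrame
import Mathlib.LinearAlgebra.Projectivization.Action
import Mathlib.FieldTheory.Finite.Basic
import HarnessLib

/-!
# Crux 23422 line `cartan` v9, stub (F2a), PRINCIPAL-SERIES half of the torus-cube cut — the STEINBERG SIMPLICITY ENGINE:
# a `GL₂(𝔽_q)`-stable space of `𝔽₃`-valued functions on `P¹(𝔽_q)` containing the constants and a non-constant function is everything
# (`3 ∤ q + 1`); equivalently the augmentation module `I₀ ⊂ 𝔽₃[P¹(𝔽_q)]` (the mod-3 Steinberg module) is simple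

Seat `bsd-stepL-tam3-p1` g21 (LINE OWNER of crux 23422; `--supports stmt-BirchSwinnertonDyer-23422 --as helper`). This is the one
modular-representation-theoretic input of the principal-series half (`q ≡ 1 (mod 3)`) of S-K1′ (bsd-idea-10 g11's cut p683297,
cartan-f2a g0's reduction files `…PSLine*`: hypothesis `hsimple` on the mod-3 line `X_M`), proved here WITHOUT Bonnafé's decomposition
theory and without the Weyl element:
* §1 `P¹(𝔽_q)` as Mathlib's `Projectivization`, with its `GL₂(𝔽_q)`-action (`g • mk v = mk (g *ᵥ v)`); the points `inf = [1:0]` and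
  `fin t = [t:1]`, the classification `eq_inf_or_fin`, the unipotent elements `uGL x = (1 x; 0 1)` (`uGL x • inf = inf`,
  `uGL x • fin t = fin (t + x)`), transitivity (`exists_smul_eq_inf`);
* §2 functions `P¹ → 𝔽₃`: translation `tr g f = f ∘ (g⁻¹ • ·)`, the total mass `tot f = f(inf) + Σ_t f(fin t)` (translation
  invariant), indicators `ind p`, the unipotent norm `normU f = Σ_x tr (uGL x) f` with `normU f (inf) = q·f(inf)` and
  `normU f (fin t) = tot f − f(inf)`;
* §3 **`steinberg_simple`**: `R ≤ (P¹ → 𝔽₃)` `G`-stable, `𝟙 ∈ R`, `R ∌` only constants ⇒ `R = ⊤`. Proof: `f := (q+1)h − (tot h)·𝟙 ∈ R`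
  has `tot f = 0`, `f ≠ 0`; translate a non-zero value to `inf`; then `normU f′ + f′(inf)·𝟙 = (q+1)·f′(inf)·ind inf`, so
  `ind inf ∈ R`, so every indicator is in `R` (transitivity). Corollary **`steinberg_augmentation_simple`**: a non-zero `G`-stable
  `N ≤ I₀ = {tot = 0}` contains `I₀`.
HONEST FRAMING: finite-group linear algebra over `𝔽₃`; nothing about any curve, `L`-value or period; S-K1′ is NOT proved here (the
principal-series inputs (P1)–(P3) remain, reduced by cartan-f2a g0 to the construction of `X_M`); no summit statement, no route item and
no registered stub is proved; BSD is proved for no curve. [folklore; background: cite: Bump1997, §4.1]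
-/

namespace Summit.BirchSwinnertonDyer.BirchSwinnertonDyer.Theorems.CartanTorusCubeCut.Steinberg

open Summit.BirchSwinnertonDyer.BirchSwinnertonDyer.Theorems.CartanTorusCubeCut
open scoped LinearAlgebra.Projectivization

set_option linter.dupNamespace false
set_option autoImplicit false

noncomputable section

open scoped Classical

variable {q : ℕ} [Fact q.Prime]

/-! ### §1 The projective line over `𝔽_q` with its `GL₂(𝔽_q)`-action -/

/-- `P¹(𝔽_q)`. -/
abbrev P1 (q : ℕ) [Fact q.Prime] : Type := ℙ (ZMod q) (Fin 2 → ZMod q)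

/-- `(1,0) ≠ 0`. -/
theorem vec10_ne_zero : (![1, 0] : Fin 2 → ZMod q) ≠ 0 := by
  intro h; have := congrFun h 0; simp at this
/-- `(t,1) ≠ 0`. -/
theorem vecT1_ne_zero (t : ZMod q) : (![t, 1] : Fin 2 → ZMod q) ≠ 0 := by
  intro h; have := congrFun h 1; simp at this

/-- the point at infinity `[1 : 0]`. -/
def inf : P1 q := Projectivization.mk (ZMod q) ![1, 0] vec10_ne_zero
/-- the finite point `[t : 1]`. -/
def fin (t : ZMod q) : P1 q := Projectivization.mk (ZMod q) ![t, 1] (vecT1_ne_zero t)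

/-- `[t : 1] ≠ [1 : 0]`. -/
theorem fin_ne_inf (t : ZMod q) : fin t ≠ (inf : P1 q) := by
  intro h
  rw [fin, inf, Projectivization.mk_eq_mk_iff'] at h
  obtain ⟨a, ha⟩ := h
  have := congrFun ha 1
  simp at this

/-- `t ↦ [t : 1]` is injective. -/
theorem fin_injective : Function.Injective (fin : ZMod q → P1 q) := by
  intro s t h
  rw [fin, fin, Projectivization.mk_eq_mk_iff'] at h
  obtain ⟨a, ha⟩ := h
  have h1 := congrFun ha 1
  have h0 := congrFun ha 0
  simp at h1 h0
  rw [h1, one_mul] at h0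
  exact h0.symm
/-- **classification**: every point is `inf` or some `fin t`. -/
theorem eq_inf_or_fin (p : P1 q) : p = inf ∨ ∃ t, p = fin t := by
  induction p using Projectivization.ind with
  | h v hv =>
    by_cases h1 : v 1 = 0
    · left
      have h0 : v 0 ≠ 0 := by
        intro h0; apply hv; ext i; fin_cases i <;> simp [h0, h1]
      rw [inf, Projectivization.mk_eq_mk_iff']
      refine ⟨v 0, ?_⟩
      ext i; fin_cases i <;> simp [h1]
    · right
      refine ⟨v 0 * (v 1)⁻¹, ?_⟩
      rw [fin, Projectivization.mk_eq_mk_iff']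
      refine ⟨v 1, ?_⟩
      ext i; fin_cases i
      · simp; field_simp
      · simp

/-- `P¹(𝔽_q) ≃ Option 𝔽_q` (`none ↦ inf`, `some t ↦ fin t`). -/
def optEquiv : Option (ZMod q) ≃ P1 q where
  toFun o := o.elim inf fin
  invFun p := if h : ∃ t, p = fin t then some (Classical.choose h) else none
  left_inv o := by
    cases o with
    | none =>
      show (if h : ∃ t, (inf : P1 q) = fin t then some (Classical.choose h) else none) = none
      rw [dif_neg]
      rintro ⟨t, ht⟩
      exact fin_ne_inf t ht.symm
    | some t =>
      show (if h : ∃ s, (fin t : P1 q) = fin s then some (Classical.choose h) else none) = some t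
      have h : ∃ s, fin t = (fin s : P1 q) := ⟨t, rfl⟩
      rw [dif_pos h]
      congr 1
      exact (fin_injective (Classical.choose_spec h)).symm
  right_inv p := by
    show (if h : ∃ t, p = fin t then some (Classical.choose h) else none).elim inf fin = p
    by_cases h : ∃ t, p = fin t
    · rw [dif_pos h]
      exact (Classical.choose_spec h).symm
    · rw [dif_neg h]
      rcases eq_inf_or_fin p with hp | hp
      · exact hp.symm
      · exact absurd hp h
/-- the unipotent element `(1 x; 0 1)`. -/
def uGL (x : ZMod q) : G q :=
  Matrix.GeneralLinearGroup.mkOfDetNeZero !![1, x; 0, 1] (by simp [Matrix.det_fin_two])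

/-- the matrix of `uGL x`. -/
theorem uGL_coe (x : ZMod q) : ((uGL x : G q) : Mat q) = !![1, x; 0, 1] := rfl
/-- the action on representatives: `g • [v] = [g v]`. -/
theorem smul_mk_eq (g : G q) (v : Fin 2 → ZMod q) (hv : v ≠ 0) :
    g • Projectivization.mk (ZMod q) v hv =
      Projectivization.mk (ZMod q) ((g : Mat q).mulVec v)
        (by
          intro h
          have h' : g • v = 0 := h
          exact ((smul_ne_zero_iff_ne g).mpr hv) h') := by
  rw [Projectivization.smul_mk]; rfl
/-- `(1 x; 0 1) • [1:0] = [1:0]`. -/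
theorem uGL_smul_inf (x : ZMod q) : uGL x • (inf : P1 q) = inf := by
  rw [inf, smul_mk_eq]
  congr 1
  rw [uGL_coe]
  ext i; fin_cases i <;> simp [Matrix.mulVec, dotProduct]

/-- `(1 x; 0 1) • [t:1] = [t + x : 1]`. -/
theorem uGL_smul_fin (x t : ZMod q) : uGL x • (fin t : P1 q) = fin (t + x) := by
  rw [fin, fin, smul_mk_eq]
  congr 1
  rw [uGL_coe]
  ext i; fin_cases i <;> simp [Matrix.mulVec, dotProduct]

/-- `(1 x; 0 1)⁻¹ = (1 −x; 0 1)`. -/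
theorem uGL_inv (x : ZMod q) : (uGL x : G q)⁻¹ = uGL (-x) := by
  rw [inv_eq_iff_mul_eq_one]
  apply Units.ext
  rw [Units.val_mul, uGL_coe, uGL_coe, Units.val_one]
  ext i j; fin_cases i <;> fin_cases j <;> simp [Matrix.mul_apply, Fin.sum_univ_two]

/-- **transitivity**: every point can be moved to `inf`. -/
theorem exists_smul_eq_inf (p : P1 q) : ∃ g : G q, g • p = inf := by
  rcases eq_inf_or_fin p with rfl | ⟨t, rfl⟩
  · exact ⟨1, one_smul _ _⟩
  · have hdet : (!![0, 1; 1, -t] : Mat q).det ≠ 0 := by simp [Matrix.det_fin_two]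
    refine ⟨Matrix.GeneralLinearGroup.mkOfDetNeZero !![0, 1; 1, -t] hdet, ?_⟩
    rw [fin, inf, smul_mk_eq]
    congr 1
    show (!![0, 1; 1, -t] : Mat q).mulVec ![t, 1] = ![1, 0]
    ext i; fin_cases i <;> simp [Matrix.mulVec, dotProduct]

/-- every point is `g • inf` for some `g`. -/
theorem exists_eq_smul_inf (p : P1 q) : ∃ g : G q, p = g • inf := by
  obtain ⟨g, hg⟩ := exists_smul_eq_inf p
  exact ⟨g⁻¹, by rw [← hg, inv_smul_smul]⟩
/-! ### §2 Functions `P¹(𝔽_q) → 𝔽₃`: translation, total mass, indicators, the unipotent norm -/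

/-- translation of functions: `(tr g f)(p) = f(g⁻¹ • p)`. -/
def tr (g : G q) (f : P1 q → ZMod 3) : P1 q → ZMod 3 := fun p => f (g⁻¹ • p)

/-- `tr` unfolded. -/
theorem tr_apply (g : G q) (f : P1 q → ZMod 3) (p : P1 q) : tr g f p = f (g⁻¹ • p) := rfl

/-- the total mass `f(inf) + Σ_t f(fin t)` (the sum over `P¹`, written without a `Fintype` instance on `P¹`). -/
def tot (f : P1 q → ZMod 3) : ZMod 3 := f inf + ∑ t : ZMod q, f (fin t)

/-- `tot` is the sum over `P¹` transported along `optEquiv`. -/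
theorem tot_eq_sum_option (f : P1 q → ZMod 3) : tot f = ∑ o : Option (ZMod q), f (optEquiv o) := by
  rw [tot, Fintype.sum_option]
  rfl

/-- **`tot` is translation-invariant** (a group element permutes `P¹`). -/
theorem tot_tr (g : G q) (f : P1 q → ZMod 3) : tot (tr g f) = tot f := by
  rw [tot_eq_sum_option, tot_eq_sum_option]
  -- the permutation of `Option 𝔽_q` induced by `g⁻¹`
  let σ : Option (ZMod q) ≃ Option (ZMod q) :=
    (optEquiv.trans (MulAction.toPerm (g⁻¹ : G q))).trans optEquiv.symm
  have hσ : ∀ o, optEquiv (σ o) = g⁻¹ • optEquiv o := fun o => by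
    show optEquiv (optEquiv.symm (MulAction.toPerm (g⁻¹ : G q) (optEquiv o))) = _
    rw [Equiv.apply_symm_apply]
    rfl
  calc ∑ o, tr g f (optEquiv o) = ∑ o, f (optEquiv (σ o)) :=
        Finset.sum_congr rfl (fun o _ => by rw [tr_apply, hσ])
    _ = ∑ o, f (optEquiv o) := Equiv.sum_comp σ (fun o => f (optEquiv o))

/-- `tot` is additive. -/
theorem tot_add (f f' : P1 q → ZMod 3) : tot (f + f') = tot f + tot f' := by
  simp only [tot, Pi.add_apply, Finset.sum_add_distrib]; ring
/-- `tot` is homogeneous. -/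
theorem tot_smul (c : ZMod 3) (f : P1 q → ZMod 3) : tot (c • f) = c * tot f := by
  simp only [tot, Pi.smul_apply, smul_eq_mul, mul_add, Finset.mul_sum]

/-- `tot 𝟙 = q + 1`. -/
theorem tot_one : tot (fun _ : P1 q => (1 : ZMod 3)) = (q : ZMod 3) + 1 := by
  rw [tot, Finset.sum_const, Finset.card_univ, ZMod.card, nsmul_eq_mul, mul_one, add_comm]

/-- the indicator of a point. -/
def ind (p₀ : P1 q) : P1 q → ZMod 3 := fun p => if p = p₀ then 1 else 0
/-- translation of an indicator: `tr g (ind p₀) = ind (g • p₀)`. -/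
theorem tr_ind (g : G q) (p₀ : P1 q) : tr g (ind p₀) = ind (g • p₀) := by
  funext p
  simp only [tr_apply, ind]
  by_cases h : p = g • p₀
  · rw [if_pos h, if_pos]; rw [h, inv_smul_smul]
  · rw [if_neg h, if_neg]; intro h'; apply h; rw [← h', smul_inv_smul]

/-- every function is a combination of indicators. -/
theorem eq_sum_ind (f : P1 q → ZMod 3) :
    f = f inf • ind inf + ∑ t : ZMod q, f (fin t) • ind (fin t) := by
  funext p
  simp only [Pi.add_apply, Finset.sum_apply, Pi.smul_apply, smul_eq_mul, ind]
  rcases eq_inf_or_fin p with rfl | ⟨t, rfl⟩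
  · rw [if_pos rfl, mul_one]
    have : ∑ x : ZMod q, f (fin x) * (if (inf : P1 q) = fin x then 1 else 0) = 0 := by
      apply Finset.sum_eq_zero
      intro x _
      rw [if_neg (fin_ne_inf x).symm, mul_zero]
    rw [this, add_zero]
  · rw [if_neg (fin_ne_inf t), mul_zero, zero_add]
    rw [Finset.sum_eq_single t]
    · rw [if_pos rfl, mul_one]
    · intro s _ hs
      rw [if_neg (fun h => hs (fin_injective h).symm), mul_zero]
    · intro h; exact absurd (Finset.mem_univ t) h

/-- the unipotent norm `Σ_x tr (uGL x) f`. -/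
def normU (f : P1 q → ZMod 3) : P1 q → ZMod 3 := ∑ x : ZMod q, tr (uGL x) f

/-- at infinity: `normU f inf = q · f inf`. -/
theorem normU_inf (f : P1 q → ZMod 3) : normU f inf = (q : ZMod 3) * f inf := by
  simp only [normU, Finset.sum_apply, tr_apply, uGL_inv, uGL_smul_inf, Finset.sum_const, Finset.card_univ,
    ZMod.card, nsmul_eq_mul]

/-- at a finite point: `normU f (fin t) = Σ_s f (fin s) = tot f − f inf`. -/
theorem normU_fin (f : P1 q → ZMod 3) (t : ZMod q) : normU f (fin t) = tot f - f inf := by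
  simp only [normU, Finset.sum_apply, tr_apply, uGL_inv, uGL_smul_fin]
  rw [tot, add_sub_cancel_left]
  exact Fintype.sum_equiv (Equiv.subLeft t) _ _ (fun x => by simp [sub_eq_add_neg])
/-! ### §3 Simplicity -/
/-- the constant function `1`. -/
def one : P1 q → ZMod 3 := fun _ => 1

/-- `one p = 1`. -/
theorem one_apply (p : P1 q) : (one : P1 q → ZMod 3) p = 1 := rfl
/-- constants are translation-invariant. -/
theorem tr_one (g : G q) : tr g (one : P1 q → ZMod 3) = one := rfl
/-- `tr` is additive. -/
theorem tr_add (g : G q) (f f' : P1 q → ZMod 3) : tr g (f + f') = tr g f + tr g f' := rfl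
/-- `tr` is homogeneous. -/
theorem tr_smul (g : G q) (c : ZMod 3) (f : P1 q → ZMod 3) : tr g (c • f) = c • tr g f := rfl

omit [Fact q.Prime] in
/-- `q + 1` is a unit mod `3` when `3 ∤ q + 1`. -/
theorem natCast_add_one_ne_zero (hq3 : ¬ 3 ∣ q + 1) : ((q : ZMod 3) + 1) ≠ 0 := by
  intro h0
  apply hq3
  have : ((q + 1 : ℕ) : ZMod 3) = 0 := by push_cast; exact h0
  exact (ZMod.natCast_eq_zero_iff _ _).1 this

/-- a function with all values equal is `f inf • one`. -/
theorem eq_smul_one_of_const {f : P1 q → ZMod 3} (h : ∀ x y, f x = f y) : f = f inf • one := by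
  funext p
  rw [Pi.smul_apply, one_apply, smul_eq_mul, mul_one]
  exact h p inf

/-- `tot (c • one) = c·(q+1)`. -/
theorem tot_smul_one (c : ZMod 3) : tot (c • (one : P1 q → ZMod 3)) = c * ((q : ZMod 3) + 1) := by
  rw [tot_smul, show tot (one : P1 q → ZMod 3) = (q : ZMod 3) + 1 from tot_one]

/-- **THE STEINBERG SIMPLICITY ENGINE.** A `GL₂(𝔽_q)`-stable subspace of the `𝔽₃`-valued functions on `P¹(𝔽_q)` that contains the
constants and some non-constant function is everything, provided `3 ∤ q + 1`. -/
theorem steinberg_simple (hq3 : ¬ 3 ∣ q + 1) (R : Submodule (ZMod 3) (P1 q → ZMod 3))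
    (hR : ∀ g : G q, ∀ f ∈ R, tr g f ∈ R) (h1 : (one : P1 q → ZMod 3) ∈ R)
    (hnc : ∃ f ∈ R, ∃ x y, f x ≠ f y) : R = ⊤ := by
  obtain ⟨h, hh, x, y, hxy⟩ := hnc
  have hq1 := natCast_add_one_ne_zero hq3
  -- an element of `R` with total mass `0` and a non-zero value
  set f : P1 q → ZMod 3 := ((q : ZMod 3) + 1) • h + (-tot h) • one with hf
  have hfR : f ∈ R := R.add_mem (R.smul_mem _ hh) (R.smul_mem _ h1)
  have hftot : tot f = 0 := by
    rw [hf, tot_add, tot_smul, tot_smul_one]; ring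
  have hfxy : f x ≠ f y := by
    intro e
    apply hxy
    have e' : ((q : ZMod 3) + 1) * (h x - h y) = 0 := by
      have := e
      simp only [hf, Pi.add_apply, Pi.smul_apply, smul_eq_mul, one_apply] at this
      linear_combination this
    rcases mul_eq_zero.1 e' with e1 | e1
    · exact absurd e1 hq1
    · exact sub_eq_zero.1 e1
  obtain ⟨p₀, hp₀⟩ : ∃ p₀, f p₀ ≠ 0 := by
    by_cases hx : f x = 0
    · exact ⟨y, fun hy => hfxy (hx.trans hy.symm)⟩
    · exact ⟨x, hx⟩
  -- move the non-zero value to `inf`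
  obtain ⟨g, hg⟩ := exists_smul_eq_inf p₀
  set f' : P1 q → ZMod 3 := tr g f with hf'
  have hf'R : f' ∈ R := hR g f hfR
  have hf'inf : f' inf = f p₀ := by
    rw [hf', tr_apply, ← hg, inv_smul_smul]
  have hf'tot : tot f' = 0 := by rw [hf', tot_tr, hftot]
  set c : ZMod 3 := f p₀ with hc
  -- the unipotent norm plus `c·1` is `(q+1)c` times the indicator of `inf`
  have hkR : normU f' + c • one ∈ R := by
    refine R.add_mem ?_ (R.smul_mem _ h1)
    rw [normU]
    exact R.sum_mem (fun x _ => hR _ _ hf'R)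
  have hk : normU f' + c • one = (((q : ZMod 3) + 1) * c) • ind inf := by
    funext p
    simp only [Pi.add_apply, Pi.smul_apply, smul_eq_mul, one_apply, ind]
    rcases eq_inf_or_fin p with rfl | ⟨t, rfl⟩
    · rw [normU_inf, hf'inf, if_pos rfl]; ring
    · rw [normU_fin, hf'tot, hf'inf, if_neg (fin_ne_inf t)]; ring
  have hcne : ((q : ZMod 3) + 1) * c ≠ 0 := mul_ne_zero hq1 hp₀
  have hind : ind (inf : P1 q) ∈ R := by
    have := R.smul_mem (((q : ZMod 3) + 1) * c)⁻¹ hkR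
    rwa [hk, smul_smul, inv_mul_cancel₀ hcne, one_smul] at this
  -- every indicator, hence everything
  have hindp : ∀ p : P1 q, ind p ∈ R := by
    intro p
    obtain ⟨g', rfl⟩ := exists_eq_smul_inf p
    rw [← tr_ind]
    exact hR _ _ hind
  rw [eq_top_iff]
  intro F _
  rw [eq_sum_ind F]
  exact R.add_mem (R.smul_mem _ (hindp _)) (R.sum_mem (fun t _ => R.smul_mem _ (hindp _)))

/-- **Corollary: the augmentation module `I₀ = {tot = 0}` (the mod-3 Steinberg module) is simple**: a non-zero `G`-stable subspace of
functions of total mass `0` contains every function of total mass `0` (`3 ∤ q + 1`). -/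
theorem steinberg_augmentation_simple (hq3 : ¬ 3 ∣ q + 1) (N : Submodule (ZMod 3) (P1 q → ZMod 3))
    (hN : ∀ g : G q, ∀ f ∈ N, tr g f ∈ N) (hN0 : ∀ f ∈ N, tot f = 0) (hne : ∃ f ∈ N, f ≠ 0) :
    ∀ f : P1 q → ZMod 3, tot f = 0 → f ∈ N := by
  have hq1 := natCast_add_one_ne_zero hq3
  intro F hF
  let R : Submodule (ZMod 3) (P1 q → ZMod 3) := N ⊔ (ZMod 3) ∙ (one : P1 q → ZMod 3)
  have hmemR : ∀ f, f ∈ R ↔ ∃ n ∈ N, ∃ c : ZMod 3, f = n + c • one := by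
    intro f
    rw [Submodule.mem_sup]
    constructor
    · rintro ⟨n, hn, z, hz, rfl⟩
      obtain ⟨c, rfl⟩ := Submodule.mem_span_singleton.1 hz
      exact ⟨n, hn, c, rfl⟩
    · rintro ⟨n, hn, c, rfl⟩
      exact ⟨n, hn, c • one, Submodule.mem_span_singleton.2 ⟨c, rfl⟩, rfl⟩
  have hR : ∀ g : G q, ∀ f ∈ R, tr g f ∈ R := by
    intro g f hf
    obtain ⟨n, hn, c, rfl⟩ := (hmemR f).1 hf
    rw [tr_add, tr_smul, tr_one]
    exact (hmemR _).2 ⟨tr g n, hN g n hn, c, rfl⟩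
  have h1 : (one : P1 q → ZMod 3) ∈ R :=
    Submodule.mem_sup_right (Submodule.mem_span_singleton_self _)
  have hnc : ∃ f ∈ R, ∃ x y, f x ≠ f y := by
    obtain ⟨f, hf, hf0⟩ := hne
    refine ⟨f, Submodule.mem_sup_left hf, ?_⟩
    by_contra hall
    push Not at hall
    apply hf0
    have hconst := eq_smul_one_of_const hall
    have ht := hN0 f hf
    rw [hconst, tot_smul_one] at ht
    rcases mul_eq_zero.1 ht with h0 | h0
    · rw [hconst, h0, zero_smul]
    · exact absurd h0 hq1
  have htop := steinberg_simple hq3 R hR h1 hnc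
  have hFR : F ∈ R := by rw [htop]; exact Submodule.mem_top
  obtain ⟨n, hn, c, hFe⟩ := (hmemR F).1 hFR
  have hc : c = 0 := by
    have := hF
    rw [hFe, tot_add, hN0 n hn, tot_smul_one, zero_add] at this
    rcases mul_eq_zero.1 this with h0 | h0
    · exact h0
    · exact absurd h0 hq1
  rw [hFe, hc, zero_smul, add_zero]
  exact hn

end

end Summit.BirchSwinnertonDyer.BirchSwinnertonDyer.Theorems.CartanTorusCubeCut.Steinberg
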